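import Summits.BirchSwinnertonDyer.Rank1Residual.X11b.FittingCongruenceLimit
import Literature.RingTheory.FittingIdeal.LocalRing
import HarnessLib

/-!
# The order ideal is divisible by the characteristic ideal; equality iff the order ideal is
# principal (cell `b2b-bsdres`, X11b route R1 — the algebra behind the erratum's use of Lemma 2.2)

HONEST FRAMING (cell `b2b-bsdres`, run/shared/lean/b2b/bsd-rank1-residual/, verbatim in every
file): the goal of the cell is to DELETE the COMBINATION-SHAPED residual classes of the
Birch–Swinnerton-Dyer formula for ALL analytic-rank `≤ 1` elliptic curves over `ℚ` — "full BSD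
formula for every rank `≤ 1` curve in class `C`" assembled STRICTLY from published theorems — so
that the rank-`≤ 1` remainder becomes exactly the CONSTRUCTION-SHAPED classes, which are TYPED
(missing-input `Prop`s), NOT attempted. This is not "finishing BSD". Sub-cell
`b2b-bsdres-multr1-p1` (X11b via the re-proof of Castella 2018 Thm. A along the author's erratum):
a RESEARCH ROUTE; no claim beyond the stated class; X11b stays CONSTRUCTION-SHAPED; nothing here
changes a label. THEOREMS ONLY (no definition, no named fact, no `sorry`); pure commutative algebra.

Context (`CastellaErratumCongruenceLimit.lean`): in the kernel form of the erratum's proof of its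
Thm. 1.1 from its Thm. 2.3 (erratum p. 4 = [Ski16, p. 192]) the input `hF` for the approximating
forms `g_m` is `Fitt_Λ(X^Σ_ac(A_{g_m})) = (L^Σ_p(g_m))`, which the erratum obtains from Thm. 2.3
(`Ch_Λ(X^Σ_ac(A_{g_m})) = (L^Σ_p(g_m))`) and "by Lemma 2.2 we know that `Ch_Λ = Fitt_Λ`" (Lemma 2.2:
no proper finite-index submodules of the Selmer group, i.e. no nonzero finite submodule of its
dual; [Ski16] Prop. 2.3.3 (ii) + the Lemma "`F^Σ = Ch^Σ`" of § 2.3). This file records, for a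
finite torsion module `M` over a Noetherian UFD `R` (`Λ_𝒪 = 𝒪⟦T⟧`, `ℤ_p⟦T⟧`), exactly how the
order ideal `Fitt₀(M)` and the characteristic ideal `char(M) = ∏_{ht 𝔭 = 1} 𝔭^{length M_𝔭}` compare:

* `pow_dvd_of_mem_fittingIdeal_zero` — locally at a nonzero principal prime `𝔭 = (π)`:
  `π^{length M_𝔭}` divides every element of `Fitt₀(M)` (`R_𝔭` is a DVR, Fitting ideals localise,
  `Fitt₀(M_𝔭) = 𝔭^{length}` by de Smit–Rubin–Schoof);
* `fittingIdeal_zero_le_charIdeal` — **`Fitt₀(M) ⊆ char(M)`** (the height-one primes carrying `M`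
  are finitely many, principal, pairwise non-associated);
* `fittingIdeal_zero_ne_bot` — `Fitt₀(M) ≠ 0` for torsion `M` (Stacks 07ZC at the prime `(0)`);
* `charIdeal_isPrincipal'` — `char(M)` is principal over a UFD;
* `fittingIdeal_zero_eq_charIdeal_iff_isPrincipal` — **`Fitt₀(M) = char(M)` iff `Fitt₀(M)` is
  principal** (with `charIdeal_eq_span_of_fittingIdeal_zero_eq_span` of
  `FittingCongruenceLimit.lean`). So what Lemma 2.2 / [Ski16] § 2.3 deliver to the argument is
  PRECISELY the principality of `Fitt_Λ(X^Σ_ac(A_{g_m}))` (classically: no nonzero pseudo-null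
  submodule ⇒ projective dimension `≤ 1` over the two-dimensional regular local ring `Λ` ⇒ a square
  presentation ⇒ `Fitt₀ = (det)`; that implication is NOT proved here);
* `fittingIdeal_zero_eq_span_of_charIdeal_eq_span` — the form consumed by
  `isTorsion_and_charIdeal_eq_of_congruences`: `char(N) = (L)` and `Fitt₀(N)` principal ⇒
  `Fitt₀(N) = (L)`.

References: C. Skinner, Pacific J. Math. 283 (2016), § 2.3 (Lemma "`F^Σ_L(f) = Ch^Σ_L(f)`") and
§ 3.1 [Skinner2016PacificMC]; F. Castella, Erratum, Lemma 2.2 and p. 4 [Castella2018Erratum];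
The Stacks Project, Tags 07ZA, 07ZC [StacksProject]; B. de Smit, K. Rubin, R. Schoof (1997) § 1
[DeSmitRubinSchoof1997]; J. Neukirch, A. Schmidt, K. Wingberg, *Cohomology of Number Fields*,
(5.3.19) (no finite submodule ⇔ `pd ≤ 1`) [NeukirchSchmidtWingberg2008].
-/

noncomputable section

open Literature.RingTheory.FittingIdeal Literature.NumberTheory.EllipticCurves
  Literature.NumberTheory.EllipticCurves.Module

namespace Summit.BirchSwinnertonDyer.Rank1Residual.X11b.CongruenceLimit

universe u

variable {R : Type u} [CommRing R]

section Local

variable [IsNoetherianRing R] [IsDomain R] {M : Type*} [AddCommGroup M] [Module R M]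
  [Module.Finite R M]

/-- **Locally, the order ideal is the `length`-th power of the prime**: for a finite module `M`
over a Noetherian domain, a nonzero principal prime `𝔭 = (π)` at which `M` has finite local length
`n`, and `x ∈ Fitt₀(M)`: `π ^ n ∣ x`. Indeed `R_𝔭` is a DVR with uniformizer `π`
(`isPrincipalIdealRing_localization_of_eq_span`), `Fitt₀(M_𝔭) = Fitt₀(M) R_𝔭`
(`Module.fittingIdeal_of_isLocalizedModule`) equals `(π)^n` (`Module.fittingIdeal_zero_eq_maximalIdeal_pow`,
de Smit–Rubin–Schoof), and `x/1 ∈ π^n R_𝔭` means `π^n ∣ s x` for some `s ∉ (π)`.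
[cite: DeSmitRubinSchoof1997, §1, p. 347] -/
theorem pow_dvd_of_mem_fittingIdeal_zero (𝔭 : PrimeSpectrum R) {π : R}
    (hπ𝔭 : 𝔭.asIdeal = Ideal.span {π}) (hπ : π ≠ 0) (hlen : lengthAt R M 𝔭 ≠ ⊤) {x : R}
    (hx : x ∈ Module.fittingIdeal R M 0) : π ^ (lengthAt R M 𝔭).toNat ∣ x := by
  obtain ⟨hPID, hmax, hirr⟩ := isPrincipalIdealRing_localization_of_eq_span 𝔭.asIdeal hπ𝔭 hπ
  haveI : IsPrincipalIdealRing (Localization.AtPrime 𝔭.asIdeal) := hPID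
  haveI : IsDiscreteValuationRing (Localization.AtPrime 𝔭.asIdeal) :=
    { not_a_field' := by
        rw [hmax, Ne, Ideal.span_singleton_eq_bot]
        exact hirr.ne_zero }
  have hprime : Prime π := (Ideal.span_singleton_prime hπ).mp (hπ𝔭 ▸ 𝔭.isPrime)
  -- the local length as a natural number
  obtain ⟨n, hn⟩ := ENat.ne_top_iff_exists.mp hlen
  have hlenMp : Module.length (Localization.AtPrime 𝔭.asIdeal)
      (LocalizedModule 𝔭.asIdeal.primeCompl M) = n := hn.symm
  rw [← hn, ENat.toNat_coe]
  -- `x/1 ∈ Fitt₀(M_𝔭) = (π/1)^n`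
  have hxmem : algebraMap R (Localization.AtPrime 𝔭.asIdeal) x ∈
      Module.fittingIdeal (Localization.AtPrime 𝔭.asIdeal)
        (LocalizedModule 𝔭.asIdeal.primeCompl M) 0 := by
    rw [Module.fittingIdeal_of_isLocalizedModule 𝔭.asIdeal.primeCompl
      (Localization.AtPrime 𝔭.asIdeal) (LocalizedModule.mkLinearMap 𝔭.asIdeal.primeCompl M) 0]
    exact Ideal.mem_map_of_mem _ hx
  rw [Module.fittingIdeal_zero_eq_maximalIdeal_pow hlenMp, hmax, Ideal.span_singleton_pow,
    ← map_pow, Ideal.mem_span_singleton] at hxmem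
  obtain ⟨y, hy⟩ := hxmem
  obtain ⟨⟨a, s⟩, rfl⟩ := IsLocalization.mk'_surjective 𝔭.asIdeal.primeCompl y
  -- clear denominators: `x * s = π^n * a` up to a unit of `R_𝔭`, hence in `R`
  have h1 : algebraMap R (Localization.AtPrime 𝔭.asIdeal) (x * s) =
      algebraMap R (Localization.AtPrime 𝔭.asIdeal) (π ^ n * a) := by
    rw [map_mul, map_mul, hy, mul_assoc, IsLocalization.mk'_spec]
  obtain ⟨c, hc⟩ := (IsLocalization.eq_iff_exists 𝔭.asIdeal.primeCompl _).mp h1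
  have hc0 : (c : R) ≠ 0 := by
    intro h
    exact c.2 (show (c : R) ∈ 𝔭.asIdeal from h ▸ 𝔭.asIdeal.zero_mem)
  have h2 : x * s = π ^ n * a := mul_left_cancel₀ hc0 hc
  have hs : ¬ π ∣ (s : R) := by
    intro h
    have hmem : (s : R) ∈ Ideal.span {π} := Ideal.mem_span_singleton.mpr h
    exact s.2 (le_of_eq hπ𝔭.symm hmem)
  exact hprime.pow_dvd_of_dvd_mul_right n hs (h2 ▸ dvd_mul_right (π ^ n) a)

end Local

section Global

variable [IsNoetherianRing R] [IsDomain R] [UniqueFactorizationMonoid R]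
  {M : Type*} [AddCommGroup M] [Module R M] [Module.Finite R M]

/-- **`Fitt₀(M) ⊆ char(M)`** for a finite torsion module over a Noetherian UFD: `char(M)` is the
finite product `∏ (π_𝔭)^{length M_𝔭}` over the height-one primes `𝔭 = (π_𝔭)` carrying `M`
(`finite_heightOne_inter_mulSupport`, `UniqueFactorizationMonoid.isPrincipal_of_height_eq_one`);
each `π_𝔭^{length M_𝔭}` divides every `x ∈ Fitt₀(M)` (`pow_dvd_of_mem_fittingIdeal_zero`), and
the `π_𝔭` are pairwise non-associated primes, so their product divides `x`. (Compare [Ski16]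
§ 2.3, proof of the Lemma `F^Σ = Ch^Σ`: "we first note that `F^Σ_L(f) ⊂ Ch^Σ_L(f)`".)
[cite: Skinner2016PacificMC, §2.3 (proof of the Lemma `F^Σ_L(f) = Ch^Σ_L(f)`)] -/
theorem fittingIdeal_zero_le_charIdeal (hM : Module.IsTorsion R M) :
    Module.fittingIdeal R M 0 ≤ charIdeal R M := by
  classical
  obtain ⟨s, hs, hs0⟩ := Submodule.exists_mem_ne_zero_of_ne_bot
    (annihilator_ne_bot_of_isTorsion M hM)
  have hsM : Module.IsTorsionBy R M s := fun m => Module.mem_annihilator.mp hs m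
  have hfin := finite_heightOne_inter_mulSupport (M := M) hs0 hsM
  set t : Finset (PrimeSpectrum R) := hfin.toFinset with ht
  have hchar : charIdeal R M = ∏ 𝔭 ∈ t, 𝔭.asIdeal ^ (lengthAt R M 𝔭).toNat := by
    unfold charIdeal
    apply finprod_mem_eq_prod_of_inter_mulSupport_eq
    rw [ht, Set.Finite.coe_toFinset, Set.inter_assoc, Set.inter_self]
  -- members of `t`: height one, in the support
  have hmem : ∀ 𝔭 ∈ t, 𝔭.asIdeal.height = 1 := fun 𝔭 h𝔭 => by
    rw [ht, Set.Finite.mem_toFinset] at h𝔭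
    exact h𝔭.1
  -- prime generators
  have hgen : ∀ 𝔭 ∈ t, ∃ π : R, π ≠ 0 ∧ 𝔭.asIdeal = Ideal.span {π} := by
    intro 𝔭 h𝔭
    obtain ⟨g, hg⟩ := UniqueFactorizationMonoid.isPrincipal_of_height_eq_one (hmem 𝔭 h𝔭)
    have hg' : 𝔭.asIdeal = Ideal.span {g} := by rw [hg, Ideal.submodule_span_eq]
    refine ⟨g, ?_, hg'⟩
    rintro rfl
    exact Ideal.ne_bot_of_height_eq_one (hmem 𝔭 h𝔭) (by rw [hg', Ideal.span_singleton_eq_bot])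
  choose! π hπ0 hπeq using hgen
  have hprime : ∀ 𝔭 ∈ t, Prime (π 𝔭) := fun 𝔭 h𝔭 =>
    (Ideal.span_singleton_prime (hπ0 𝔭 h𝔭)).mp (hπeq 𝔭 h𝔭 ▸ 𝔭.isPrime)
  have hchar' : charIdeal R M =
      Ideal.span {∏ 𝔭 ∈ t, π 𝔭 ^ (lengthAt R M 𝔭).toNat} := by
    rw [hchar, ← Ideal.prod_span_singleton]
    exact Finset.prod_congr rfl fun 𝔭 h𝔭 => by rw [hπeq 𝔭 h𝔭, Ideal.span_singleton_pow]
  intro x hx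
  rw [hchar', Ideal.mem_span_singleton]
  -- local divisibility at each `𝔭 ∈ t`
  have hloc : ∀ 𝔭 ∈ t, π 𝔭 ^ (lengthAt R M 𝔭).toNat ∣ x := fun 𝔭 h𝔭 =>
    pow_dvd_of_mem_fittingIdeal_zero 𝔭 (hπeq 𝔭 h𝔭) (hπ0 𝔭 h𝔭)
      (lengthAt_ne_top_of_isTorsionBy hs0 hsM 𝔭 (hmem 𝔭 h𝔭).le) hx
  -- assemble by induction over sub-finsets of `t`
  suffices key : ∀ t' : Finset (PrimeSpectrum R), t' ⊆ t →
      (∏ 𝔭 ∈ t', π 𝔭 ^ (lengthAt R M 𝔭).toNat) ∣ x from key t le_rfl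
  intro t' ht'
  induction t' using Finset.induction_on with
  | empty => simp
  | insert 𝔮 t' h𝔮 ih =>
    have h𝔮t : 𝔮 ∈ t := ht' (Finset.mem_insert_self 𝔮 t')
    have hsub : t' ⊆ t := fun 𝔭 h𝔭 => ht' (Finset.mem_insert_of_mem h𝔭)
    obtain ⟨y, hy⟩ := ih hsub
    rw [Finset.prod_insert h𝔮, mul_comm]
    -- `π 𝔮` does not divide the product over `t'`
    have hnd : ¬ π 𝔮 ∣ ∏ 𝔭 ∈ t', π 𝔭 ^ (lengthAt R M 𝔭).toNat := by
      intro hdvd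
      obtain ⟨𝔭, h𝔭, hdiv⟩ := (Prime.dvd_finsetProd_iff (hprime 𝔮 h𝔮t) _).mp hdvd
      have hππ : π 𝔮 ∣ π 𝔭 := (hprime 𝔮 h𝔮t).dvd_of_dvd_pow hdiv
      have hle : 𝔭.asIdeal ≤ 𝔮.asIdeal := by
        rw [hπeq 𝔭 (hsub h𝔭), hπeq 𝔮 h𝔮t]
        exact Ideal.span_singleton_le_span_singleton.mpr hππ
      have heq : 𝔭.asIdeal = 𝔮.asIdeal :=
        eq_of_height_le_one_of_le (hmem 𝔮 h𝔮t).le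
          (Ideal.ne_bot_of_height_eq_one (hmem 𝔭 (hsub h𝔭))) hle
      exact h𝔮 (PrimeSpectrum.ext heq ▸ h𝔭)
    have h𝔮x : π 𝔮 ^ (lengthAt R M 𝔮).toNat ∣ (∏ 𝔭 ∈ t', π 𝔭 ^ (lengthAt R M 𝔭).toNat) * y :=
      hy ▸ hloc 𝔮 h𝔮t
    rw [hy]
    exact mul_dvd_mul_left _ ((hprime 𝔮 h𝔮t).pow_dvd_of_dvd_mul_left _ hnd h𝔮x)

omit [IsNoetherianRing R] [UniqueFactorizationMonoid R] in
/-- **`Fitt₀(M) ≠ 0` for a finite torsion module over a domain** (Stacks 07ZC at the prime `(0)`: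
`M_{(0)} = 0` is generated by `0` elements, so `Fitt₀(M) ⊄ (0)`).
[cite: StacksProject, Tag 07ZC] -/
theorem fittingIdeal_zero_ne_bot (hM : Module.IsTorsion R M) : Module.fittingIdeal R M 0 ≠ ⊥ := by
  haveI : Subsingleton (LocalizedModule (⊥ : Ideal R).primeCompl M) := by
    refine (LocalizedModule.subsingleton_iff).mpr fun m => ?_
    obtain ⟨a, ha⟩ := @hM m
    exact ⟨a, fun h => nonZeroDivisors.ne_zero a.2 h, ha⟩
  have hy : Submodule.span (Localization.AtPrime (⊥ : Ideal R))
      (Set.range (Fin.elim0 : Fin 0 → LocalizedModule (⊥ : Ideal R).primeCompl M)) = ⊤ :=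
    Subsingleton.elim _ _
  obtain ⟨d, hd, hd0⟩ := Module.exists_mem_fittingIdeal_notMem (M := M) (⊥ : Ideal R)
    (Localization.AtPrime (⊥ : Ideal R)) (LocalizedModule.mkLinearMap (⊥ : Ideal R).primeCompl M)
    Fin.elim0 hy
  intro h
  rw [h] at hd
  exact hd0 hd

omit [IsNoetherianRing R] in
/-- The characteristic ideal of any module over a Noetherian UFD is principal (height-one primes
are principal, `UniqueFactorizationMonoid.isPrincipal_of_height_eq_one`; the tree's
`charIdeal_isPrincipal_holds` is the case `Λ = ℤ_p⟦T⟧`). [cite: Washington1997, §13.2] -/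
theorem charIdeal_isPrincipal' (M : Type*) [AddCommGroup M] [Module R M] :
    (charIdeal R M).IsPrincipal := by
  unfold charIdeal
  rw [← Ideal.mem_isPrincipalSubmonoid_iff]
  refine finprod_mem_induction (· ∈ Ideal.isPrincipalSubmonoid R)
    (Submonoid.one_mem _) (fun _ _ hx hy => Submonoid.mul_mem _ hx hy) ?_
  intro 𝔭 h𝔭
  refine Submonoid.pow_mem _ ?_ _
  obtain ⟨g, hg⟩ := UniqueFactorizationMonoid.isPrincipal_of_height_eq_one h𝔭
  rw [hg]
  exact Ideal.span_singleton_mem_isPrincipalSubmonoid g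

/-- **`Fitt₀(M) = char(M)` iff `Fitt₀(M)` is principal** (finite torsion `M` over a Noetherian
UFD). `⇒`: `char` is principal. `⇐`: a principal nonzero order ideal `(L)` is the characteristic
ideal (`charIdeal_eq_span_of_fittingIdeal_zero_eq_span`, height-one localisation). This pins down
what the erratum's Lemma 2.2 / [Ski16] Prop. 2.3.3 (ii) contribute to "`Ch = Fitt`": the
PRINCIPALITY of the order ideal (classically via "no nonzero pseudo-null submodule ⇒ `pd_Λ ≤ 1` ⇒
square presentation", [NSW] (5.3.19) — not formalised here).
[cite: Skinner2016PacificMC, §2.3 (Lemma `F^Σ_L(f) = Ch^Σ_L(f)`)]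
[cite: NeukirchSchmidtWingberg2008, (5.3.19)] -/
theorem fittingIdeal_zero_eq_charIdeal_iff_isPrincipal (hM : Module.IsTorsion R M) :
    Module.fittingIdeal R M 0 = charIdeal R M ↔ (Module.fittingIdeal R M 0).IsPrincipal := by
  constructor
  · intro h
    rw [h]
    exact charIdeal_isPrincipal' M
  · intro hP
    have hspan : Module.fittingIdeal R M 0 =
        Ideal.span {Submodule.IsPrincipal.generator (Module.fittingIdeal R M 0)} :=
      (Ideal.span_singleton_generator _).symm
    have hL : Submodule.IsPrincipal.generator (Module.fittingIdeal R M 0) ≠ 0 := by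
      intro h0
      exact fittingIdeal_zero_ne_bot hM (by rw [hspan, h0, Ideal.span_singleton_eq_bot])
    exact hspan.trans (charIdeal_eq_span_of_fittingIdeal_zero_eq_span hspan hL).symm

/-- **The form consumed by the congruence skeleton**: if `char(N) = (L)` (Thm. 2.3 for `g_m`) and
`Fitt₀(N)` is principal (what Lemma 2.2 supplies) for a finite torsion `N` over a Noetherian UFD,
then `Fitt₀(N) = (L)` — hypothesis `hF` of `isTorsion_and_charIdeal_eq_of_congruences`.
[cite: Castella2018Erratum, proof of Thm. 1.1 (p. 4), "by Lemma 2.2 we know that Ch = Fitt"] -/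
theorem fittingIdeal_zero_eq_span_of_charIdeal_eq_span (hM : Module.IsTorsion R M)
    (hP : (Module.fittingIdeal R M 0).IsPrincipal) {L : R} (hCh : charIdeal R M = Ideal.span {L}) :
    Module.fittingIdeal R M 0 = Ideal.span {L} := by
  rw [(fittingIdeal_zero_eq_charIdeal_iff_isPrincipal hM).mpr hP, hCh]

end Global

end Summit.BirchSwinnertonDyer.Rank1Residual.X11b.CongruenceLimit

end
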